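import Summits.CriticalPhenomena.CardyFormulaZ2.Theorems.EdgeCoherence.Negative.CornerObservableRigidity

/-!
# `EdgeCoherence` (route `CardyComplexCone`, stmt-CriticalPhenomena-11385): the non-degeneracy
# clause is the only content guard, and it does not exclude the degenerate reading

Planner information from the cdisprove unit (refuter `refuter-cdisprove-stmt-CriticalPhenomena-11385-0`):

* `edgeCoherence_without_nonzero` — with the clause `∃ o, IsCorner 0 o ∧ u o ≠ 0` DROPPED the
  crux is trivially TRUE (`u = 0`): the clause is load-bearing for content.
* `edgeCoherence_of_classSmall` — the clause as filed (`u ≠ 0` on ONE corner class) lets the crux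
  hold in the DEGENERATE reading: if three of the four corner classes are `o(δ^{1/3})` locally
  uniformly (`ClassSmall`), then `EdgeCoherence` holds with `u` = indicator of the fourth class,
  with no information whatsoever on that class.  In that reading the route's `Target` and
  `CoherentMorera` carry no content and everything moves into `ParafermionToSLESixFamilies` with a
  zero limit (cf. refuter g43-14's note on the item).  Intended repair (planner's call): require
  `u o ≠ 0` on all four classes, or add the lower bound `‖E_δ‖ ≥ c δ^{1/3}` class by class
  (the route implicitly bets exact order `δ^{1/3}`; heuristically `u ∝ (1,1,1,1)`).
-/

noncomputable section

open MeasureTheory Filter Topology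
open Literature.Probability.LatticeModels Literature.Probability.RandomPlanarGeometry
open Literature.Probability.Percolation

namespace Summit.CriticalPhenomena.CardyFormulaZ2.Theorems.EdgeCoherence.Negative

open Summit.CriticalPhenomena.CardyFormulaZ2.Theses.CardyComplexCone (EdgeCoherence)

/-! ## §1 The non-degeneracy clause is the only content guard -/

/-- **Without the non-degeneracy clause the crux is trivially TRUE** (`u = 0`): the clause
`∃ o, IsCorner 0 o ∧ u o ≠ 0` is load-bearing for CONTENT (not for truth). -/
theorem edgeCoherence_without_nonzero :
    ∃ u : Site 2 → ℂ,
      ∀ (D : DobrushinDomain) (Λ : ℝ → DiscreteDobrushin), (∀ δ, (Λ δ).Ω = D.carrier) →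
        (∀ δ, (Λ δ).δ = δ) → (∀ᶠ δ in 𝓝[>] (0:ℝ), (Λ δ).IsZdAdmissible) →
          ∀ K : Set ℂ, IsCompact K → K ⊆ D.carrier → CoherentOn u Λ K := by
  refine ⟨0, fun D Λ _ _ _ K _ _ ε hε => ?_⟩
  filter_upwards [self_mem_nhdsWithin] with δ hδ v f f' _ _ _
  simp only [Pi.zero_apply, zero_mul, sub_zero, norm_zero]
  exact mul_nonneg hε.le (Real.rpow_nonneg (le_of_lt hδ) _)

/-- The corner class `o` (an offset with `IsCorner 0 o`) is NEGLIGIBLE: `E_δ(v, v + o) = o(δ^{1/3})`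
locally uniformly, for every domain and family (the degenerate reading of one class). -/
def ClassSmall (o : Site 2) : Prop :=
  ∀ (D : DobrushinDomain) (Λ : ℝ → DiscreteDobrushin), (∀ δ, (Λ δ).Ω = D.carrier) →
    (∀ δ, (Λ δ).δ = δ) → (∀ᶠ δ in 𝓝[>] (0:ℝ), (Λ δ).IsZdAdmissible) →
      ∀ K : Set ℂ, IsCompact K → K ⊆ D.carrier → ∀ ε > (0:ℝ), ∀ᶠ δ in 𝓝[>] (0:ℝ),
        ∀ v f : Site 2, IsCorner v f → f - v = o → meshPoint δ v ∈ K →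
          ‖cornerObs Λ δ v f‖ ≤ ε * δ ^ ((1:ℝ) / 3)

/-- Offsets of corners: `IsCorner v f` gives `IsCorner 0 (f - v)`. [folklore] -/
theorem isCorner_zero_sub {v f : Site 2} (h : IsCorner v f) : IsCorner 0 (f - v) := by
  intro i
  rcases h i with h | h
  · left; simp [h]
  · right; simp [h]

/-- The set of corner offsets is finite (it is `{0,-1}²`). [folklore] -/
theorem finite_cornerOffsets : {o : Site 2 | IsCorner 0 o}.Finite := by
  refine (Set.Finite.pi (t := fun _ : Fin 2 => ({0, -1} : Set ℤ)) fun _ => Set.toFinite _).subset ?_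
  intro o ho i _
  rcases ho i with h | h
  · left; exact h.symm
  · right
    simp only [Set.mem_singleton_iff]
    have h' : (0:ℤ) = o i + 1 := by simpa using h
    omega

/-- **Degenerate reading not excluded.**  If the three corner classes other than `o₀` are
negligible, `EdgeCoherence` holds with `u` = indicator of `o₀` — with NO information on the class
`o₀` (in particular the route's Target/CoherentMorera then carry no content).  The filed clause
`u o ≠ 0` on one class is an anti-vacuity guard only. [folklore] -/
theorem edgeCoherence_of_classSmall (o₀ : Site 2) (ho₀ : IsCorner 0 o₀)
    (h : ∀ o : Site 2, IsCorner 0 o → o ≠ o₀ → ClassSmall o) : EdgeCoherence := by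
  classical
  rw [edgeCoherence_iff]
  refine ⟨fun o => if o = o₀ then 1 else 0, ⟨o₀, ho₀, by simp⟩, ?_⟩
  intro D Λ h1 h2 h3 K hK hKD ε hε
  have key : ∀ o ∈ {o : Site 2 | IsCorner 0 o}, ∀ᶠ δ in 𝓝[>] (0:ℝ), o ≠ o₀ →
      ∀ v f : Site 2, IsCorner v f → f - v = o → meshPoint δ v ∈ K →
        ‖cornerObs Λ δ v f‖ ≤ ε * δ ^ ((1:ℝ) / 3) := by
    intro o ho
    by_cases hne : o = o₀
    · exact Eventually.of_forall fun δ h' => absurd hne h'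
    · exact (h o ho hne D Λ h1 h2 h3 K hK hKD ε hε).mono fun δ hδ _ => hδ
  have key' := (finite_cornerOffsets.eventually_all).2 key
  filter_upwards [key', self_mem_nhdsWithin] with δ hδ hpos v f f' hf hf' hv
  have hnn : (0:ℝ) ≤ ε * δ ^ ((1:ℝ) / 3) :=
    mul_nonneg hε.le (Real.rpow_nonneg (le_of_lt hpos) _)
  by_cases hfo : f - v = o₀ <;> by_cases hfo' : f' - v = o₀
  · have : f = f' := by
      have := hfo.trans hfo'.symm
      exact sub_left_injective this
    subst this
    simpa using hnn
  · simp only [hfo, hfo', if_true, if_false, zero_mul, one_mul, zero_sub, norm_neg]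
    exact hδ (f' - v) (isCorner_zero_sub hf') hfo' v f' hf' rfl hv
  · simp only [hfo, hfo', if_true, if_false, zero_mul, one_mul, sub_zero]
    exact hδ (f - v) (isCorner_zero_sub hf) hfo v f hf rfl hv
  · simpa [hfo, hfo'] using hnn


end Summit.CriticalPhenomena.CardyFormulaZ2.Theorems.EdgeCoherence.Negative

end
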